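import Summits.QuantumFields.YangMills.Theorems.BalabanUVNodesN16OfSocketsZd3
import Literature.MathematicalPhysics.QuantumFieldTheory.Balaban1983to89.B8SockH59NotAtUnivDegenerate
import HarnessLib

/-!
# Route «BalabanUVNodes» (K3⁗ `SpineGivenEndpointR13Sep`), DAG node N16 = NE3 — THE N05 → N16 EDGE RE-KEYED AT THE ALL-TORUS PROPER MEMBERS of n05-a's
# family `zdGF3 (M_n ℂ) L β len` (`Ω_j = ℤ⁴` for every `j`, constraint data `Λs m j = {j = m}`, `Λb m j = {j = m}` at EVERY truncation — print's
# «Ω_j = T_η», p. 77), after this seat's certificate that n05-a's (1.59)-socket `SockH59` is FALSE at univ members with EMPTY lower-truncation data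
# (`Literature.….B8SockH59NotAtUnivDegenerate.not_forall_univ_sockH59`): the univ-keyed socket binders of generation 5's file 42
# (`N16OfSocketsZd3.n16_of_socketsZd3E` ∕ `…_l1Len` ∕ `…HFP₄…`) are VACUOUS as stated; THIS file keys the five sockets where N16 actually reads them

Cell `pub-ymgap`, seat `pub-ymgap-dag-n16-c` (R134 fan-out seat, strategy s1; HUMAN RULING D-0062; chair R424 venue), generation 6, file 45 — over
generation 0's files 4b ∕ 5 (`N16.Thm4ZdPrintOfLeaf.thm4TorusAt_zero_print_of_leaf_member`, `N16.OfLeaf.thm4TorusAt_print_of_leaf` ∕ `n16_of_leaf`),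
generation 5's file 42 (`N16OfSocketsZd3`) and n05-a's index-mapped knits `B8LeafKnitZd3E.thm4Printed_zd3_mapE` ∕ `B8LeafModelZd3Map.prop3Printed_zd3_map`.
`--supports stmt-QuantumFields-20292 --as helper` (K3⁗, dag-lead WORDS-140).  `bears_on: R4∕N16 · edge N05 → N16`.

WHY.  N16's chain instantiates [Balaban1985RegularSpaces] Theorem 4 ∕ Proposition 3 at ONE member of `zdGF3` per level `k`: the ALL-TORUS member
with PROPER constraint data at every truncation (`B8LeafModelZd3NonVacuity.exists_member_univ`; hypothesis `hΛs : ∀ m j, i.Λs m j = {j = m}` of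
`thm4TorusAt_zero_print_of_leaf_member`).  Generation 5 keyed the N05-socket at the larger sub-index `{i // i.Ω 0 = univ}` (repair shape (R-b′) after
n05-e's cube-member certificates).  But the index `ZdIdx` leaves the constraint data of the truncations `m < k` free (laws `hbox`∕`hclass` only), and at
a univ member with EMPTY truncation-1 data the socket `SockH59` is false (this seat's Literature certificate, constant abelian pure-gauge witness), so
«`SockH59` at every univ member» is unsatisfiable for every `B₀ > 0, B₀′ ≥ 0, cP > 0`.  The sound key pins the truncation data too: the all-torus
proper sub-index `{i : ZdIdx 4 L // (∀ j, i.Ω j = univ) ∧ (∀ m j, i.Λs m j = {j = m}) ∧ (∀ m j, i.Λb m j = {j = m})}` (spelled inline; no `def`),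
on which neither the corner witness (no boundary) nor the empty-data witness (proper data) applies, and which contains every member N16 reads.

WHAT THIS FILE PROVES (kernel, theorems only, 0 `def`, 0 sorry):
* §0 `not_forall_univ_sockH59_matrix` — the `SockH59` binder of generation 5's file 42 (`∀ i : {i // i.Ω 0 = univ}, SockH59 (𝔸 := M_n ℂ) …`) is
  unsatisfiable for every `L ≥ 1`, `B₀ > 0`, `B₀′ ≥ 0`, `c > 0`: `n16_of_socketsZd3E`, `n16_holderMS_of_socketsZd3E_l1Len`, `n16_holderMS_of_socketsHFP₄_l1Len`
  (p505708) are VACUOUS as stated (this seat's Literature certificate at the N16 face).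
* §1 `thm4TorusAt_zero_print_of_leaf_allTorus` — file 4b's `…_of_leaf_univ` with `B8.Thm4Body` ∕ `B8.Prop3Body` read on the all-torus proper sub-family
  (any `d ≥ 2`, C⋆-algebra `𝔸`); `thm4TorusAt_print_of_leaf_allTorus` — file 5's (T4^ℤᵈ_print) at `η = L^{−k}` from the same (`M_n ℂ`).
* §2 `n16_of_leafAllTorus` — file 5's `n16_of_leaf` (β = 1, the root of record `NE3EnergyRateWCov 4 (sfClass 4 L N ε) …`) with the two leaf clauses
  read on the all-torus proper sub-family; conclusion VERBATIM.
* §3 ★ `n16_of_socketsAllTorus` — file 42's `n16_of_socketsZd3E` with n05-a's five sockets `SockP5base ∕ SockP5 ∕ SockH59 ∕ SockP5uE ∕ SockB9P3`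
  demanded AT THE ALL-TORUS PROPER MEMBERS ONLY (`thm4Printed_zd3_mapE` ∕ `prop3Printed_zd3_map` at `ι := Subtype.val` of that sub-index);
  conclusion VERBATIM.

HONEST FRAMING: a re-key by name; nothing of Bałaban is proved here; the five sockets at the all-torus proper members ([Balaban1985RegularSpaces]
Prop. 5 (1.107)–(1.109), (1.59) = [4] Thm 3.3, the Prop-3-frame b9 lines, on the `ℤ⁴` carriers with `Ω_j = ℤ⁴`) are node N05's ∕ N06's open
obligations, (H3ˢᵘᵖ) = N07's [Balaban1985Variational] Thm 1 TYPE; N16 ∕ NE3 NOT discharged; count-neutral; one finite four-torus at fixed ε —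
NOT ℝ⁴, NOT infinite volume, NOT OS, NOT a mass gap, NOT Clay.
-/

set_option autoImplicit false

open scoped BigOperators Matrix Matrix.Norms.L2Operator
open NormedSpace

namespace Summit.QuantumFields.YangMills.BalabanUVNodes.N16OfSocketsAllTorus

open Literature.MathematicalPhysics.QuantumFieldTheory.Balaban1983to89
open B7Prop1Explicit B7Prop2Explicit
open B7Prop3Flat (c3)
open B7Eq78Linearization (conjR)
open B7Eq92Concrete (mgauge)
open B8Ineq132 (InAk covDerivFwd)
open B8Eq184Proof (cfgExp)
open B8Eq119TwistedAxial (Restr129)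
open B8Eq133Hypotheses (Reg335Zd)
open B8Eq138LandauZd (IsLandau138 covLap)
open B9Eq340HolderZd (AdmPair mem_admPair)
open B8Thm4TorusAt (torusLam Thm4TorusAt)
open B8LeafModelZd (ZdIdx SockP5base SockP5 SockH59)
open B8LeafModelZd3 (zdGF3 SockB9P3)
open B8LeafModelZdSockP5uE (SockP5uE)
open B8LeafModelZd3NonVacuity (exists_member_univ)
open Summit.QuantumFields.BalabanUV.T4Continuum
open T4AveragingDeficitWall (Ad)
open BlockAverageCurrent (curConst)
open NE3EnergyWeightedCovShape (NE3EnergyRateWCov)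
open NE3RightInverseSupLetters (frameC)
open NE3.LeafIndexSockets (LeafH3sup)
open MinimalActionRate (sfClass)
open Summit.QuantumFields.YangMills.BalabanUVNodes.N16.Thm4ZdPrintOfLeaf (thm4TorusAt_zero_print_of_leaf_member)
open Summit.QuantumFields.YangMills.BalabanUVNodes.N16.OfLeaf (exists_window_print thm4TorusAt_concl_congr)
open Summit.QuantumFields.YangMills.BalabanUVNodes.N16 (n16_of_thm4Zd_print)

noncomputable section

variable {d : ℕ}

/-! ## §0 The univ-keyed (1.59)-socket binder of generation 5's file 42 is unsatisfiable (this seat's certificate, read at the N16 face) -/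

section Vacuity

variable {n : Type} [Fintype n] [DecidableEq n]

/-- **THE `SockH59` BINDER OF `N16OfSocketsZd3.n16_of_socketsZd3E` ∕ `n16_holderMS_of_socketsZd3E_l1Len` ∕ `n16_holderMS_of_socketsHFP₄_l1Len` IS
UNSATISFIABLE** (`d = 4`, `𝔸 = M_n(ℂ)` with the `L²`-operator-norm C⋆-structure, `n` nonempty; every `L ≥ 1`, `B₀ > 0`, `B₀′ ≥ 0`, threshold `c > 0`):
`¬ ∀ i : {i : ZdIdx 4 L // i.Ω 0 = univ}, SockH59 L B₀ B₀′ c i.η i.k i.Ω i.Λs i.Λb` — `B8SockH59NotAtUnivDegenerate.not_forall_univ_sockH59` (the index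
`ZdIdx` admits univ members with EMPTY truncation-1 constraint data, where the socket is refuted by a constant abelian pure gauge).  So those three
theorems of generation 5 (p505708; all under `0 < B₀`, `0 < B₀′`, `0 < cP` ∕ `0 < c59`) are VACUOUS as stated; their un-vacated content is §3.
Nothing printed is refuted. [cite: Balaban1985RegularSpaces, (1.59) p.86, Thm 4 p.88, p.77 («Ω_j = T_η», 𝔅_m); Balaban1985BackgroundPropagators, Thm 3.3 p.399] -/
theorem not_forall_univ_sockH59_matrix [Nonempty n] {L : ℕ} (hL : 1 ≤ L) {B₀ B₀' c : ℝ} (hB₀ : 0 < B₀) (hB₀' : 0 ≤ B₀') (hc : 0 < c) :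
    letI : CStarAlgebra (Matrix n n ℂ) := {}
    ¬ ∀ i : {i : ZdIdx 4 L // i.Ω 0 = Set.univ}, SockH59 (𝔸 := Matrix n n ℂ) L B₀ B₀' c i.1.η i.1.k i.1.Ω i.1.Λs i.1.Λb := by
  letI : CStarAlgebra (Matrix n n ℂ) := {}
  exact B8SockH59NotAtUnivDegenerate.not_forall_univ_sockH59 (d := 4) (by norm_num) hL hB₀ hB₀' hc

end Vacuity

/-! ## §1 Theorem 4 ∧ Proposition 3 on the ALL-TORUS PROPER sub-family ⟹ N16's `ℤᵈ` reading (files 4b ∕ 5 re-keyed) -/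

section General

variable {𝔸 : Type} [CStarAlgebra 𝔸] [Nontrivial 𝔸]

/-- **N16's `ℤᵈ` READING WITH PRINT's LIST FROM THE LEAF ON THE ALL-TORUS PROPER SUB-FAMILY** (index `{i // (∀ j, i.Ω j = univ) ∧ (∀ m j, i.Λs m j =
{j = m}) ∧ (∀ m j, i.Λb m j = {j = m})}` — print's «Ω_j = T_η» members with the canonical constraint data at every truncation): `B8.Thm4Body c₁ B₁′` and
`B8.Prop3Body cP d L C₂ inp B₀β` on `fun i ↦ zdGF3 𝔸 L β len i.1` over that sub-index, with the letters of file 4b §2, give at EVERY `k ≥ 1`, `η > 0`,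
for every `Reg`: `Thm4TorusAt L k 0 η c₁′ (unitaryUnits 𝔸) Reg (Restr129 L k (torusLam k)) Concl_P` (file 4b's `…_member` at the member of
`exists_member_univ`, which lies in the sub-index).  Twin of `N16.Thm4ZdPrintOfLeaf.thm4TorusAt_zero_print_of_leaf_univ` with the SMALLER index.
[cite: Balaban1985RegularSpaces, Thm 4 p.88, Prop. 3 p.87, p.77 («Ω_j = T_η»)] -/
theorem thm4TorusAt_zero_print_of_leaf_allTorus (hd2 : 2 ≤ d) {L : ℕ} (hL : 2 ≤ L) {β : ℝ} (hβ : 0 ≤ β) {len : Site d → ℝ}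
    (hlen : ∀ v : Site d, 0 < len v → 1 ≤ len v) {c₁ c₁' B₁' cP C₂ B₀β : ℝ} {inp : B8.B9Inputs} (hB₁' : 0 < B₁')
    (hBB : 5 * (d : ℝ) * L * inp.B₀ ≤ B₁')
    (hwin : ∀ α₀ α₁ : ℝ, 0 < α₀ → 0 < α₁ → α₀ + α₁ ≤ c₁' →
      α₀ + α₁ ≤ c₁ ∧ C0 d * (2 * α₀) ≤ 1 / 3 ∧ 4 * α₀ ≤ c2' d L ∧ 16 * (B₁' * (α₀ + α₁)) ≤ 1 ∧
      Real.exp (4 * (800 * ((d : ℝ) + 1) ^ 2 * ((d : ℝ) + 4)) * α₀) * (1 + 8 * (131072 * ((d : ℝ) + 1) ^ 2) * (B₁' * (α₀ + α₁))) ≤ 2 ∧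
      2 * (B₁' * (α₀ + α₁)) ≤ c3 d L ∧ (d : ℝ) * L * α₁ ≤ 1 / 8 ∧ α₀ ≤ cP ∧ α₁ ≤ cP ∧ B₁' * (α₀ + α₁) ≤ cP ∧
      2 * (B₁' * (α₀ + α₁)) ^ 2 + 20 * d * α₀ * (B₁' * (α₀ + α₁)) + 2 * C₂ * (B₁' * (α₀ + α₁)) ^ 2 ≤ α₀ + α₁)
    (hT : B8.Thm4Body c₁ B₁' (fun i : {i : ZdIdx d L // (∀ j, i.Ω j = Set.univ) ∧ (∀ m j, i.Λs m j = {_y | j = m}) ∧ (∀ m j, i.Λb m j = {_c | j = m})} =>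
      (zdGF3 𝔸 L β len i.1).toGFData))
    (hP : B8.Prop3Body cP d (L : ℝ) C₂ inp B₀β (fun i : {i : ZdIdx d L // (∀ j, i.Ω j = Set.univ) ∧ (∀ m j, i.Λs m j = {_y | j = m}) ∧ (∀ m j, i.Λb m j = {_c | j = m})} =>
        (zdGF3 𝔸 L β len i.1).toGFData2))
    {k : ℕ} (hk : 1 ≤ k) {η : ℝ} (hη : 0 < η) (Reg : (Site d → Fin d → 𝔸ˣ) → Prop) :
    Thm4TorusAt L k 0 η c₁' (unitaryUnits 𝔸) Reg (Restr129 L k (torusLam k))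
      (fun (α₀ α₁ : ℝ) (U₀ U' : Site d → Fin d → 𝔸ˣ) (u : Site d → 𝔸ˣ) =>
        ∃ A : Site d → Fin d → 𝔸,
          (∀ x μ, IsSelfAdjoint (A x μ)) ∧ mgauge U₀ u (cfgExp η A) = U' ∧
          (∀ x μ, ‖A x μ‖ ≤ 5 * (d : ℝ) * L * inp.B₀ * (α₀ + α₁) * ((L : ℝ) ^ k * η)⁻¹) ∧
          (∀ (μ : Fin d) (x : Site d) (κ : Fin d),
            ‖covDerivFwd η U₀ μ (fun z => A z κ) x‖ ≤ 5 * (d : ℝ) * L * inp.B₀ * (α₀ + α₁) * ((L : ℝ) ^ k * η) ^ (-(2 : ℝ))) ∧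
          IsLandau138 L k η Set.univ (torusLam k) U₀ A ∧
          (∀ (μ : Fin d) (y : Site d) (κ : Fin d), (y, y + e μ) ∈ AdmPair η len →
            ‖conjR (U₀ y μ) (covDerivFwd η U₀ μ (fun z => A z κ) (y + e μ)) - covDerivFwd η U₀ μ (fun z => A z κ) y‖
              ≤ 5 * (d : ℝ) * L * B₀β * (α₀ + α₁) * ((L : ℝ) ^ k * η) ^ (-(2 + β)) * (η * len (e μ)) ^ β) ∧
          (∀ (x : Site d) (κ : Fin d),
            ‖covLap η U₀ (fun z => A z κ) x‖ ≤ 5 * (d : ℝ) * L * inp.B₀ * (α₀ + α₁) * ((L : ℝ) ^ k * η) ^ (-(3 : ℝ)))) := by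
  obtain ⟨i, -, hik, hiη, hΩ, hΛs, hΛb⟩ := exists_member_univ (d := d) (le_trans (by norm_num) hL) hk hη
  subst hik hiη
  exact thm4TorusAt_zero_print_of_leaf_member hd2 hL hβ hlen i hΩ hΛs hB₁' hBB hwin Reg (hT ⟨i, hΩ, hΛs, hΛb⟩)
    (hP ⟨i, hΩ, hΛs, hΛb⟩)

end General

section Matrices

variable {n : Type} [Fintype n] [DecidableEq n]

/-- **THE LEAF CLAUSES ON THE ALL-TORUS PROPER SUB-FAMILY ⟹ FILE 2's (T4^ℤᵈ_print), VERBATIM** (`𝔸 = M_n(ℂ)`; `d, L ≥ 2`; Hölder data `β ≥ 0`,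
`len ≥ 1` on its support, `len e_μ = 1`; constants and window as in file 4b): twin of `N16.OfLeaf.thm4TorusAt_print_of_leaf` (same proof, `§1` in
place of the univ-family lemma) — at every `k ≥ 1`, `Thm4TorusAt L k 0 (Lᵏ)⁻¹ c₁′ unitaryUnits (Reg k) (Restr129 L k (torusLam k)) Concl⁰_print`.
[cite: Balaban1985RegularSpaces, Thm 4 p.88, Prop. 3 p.87, (1.36)–(1.39) pp.82–83, p.77 («Ω_j = T_η»)] -/
theorem thm4TorusAt_print_of_leaf_allTorus [Nonempty n] (hd2 : 2 ≤ d) {L : ℕ} (hL : 2 ≤ L) {β : ℝ} (hβ : 0 ≤ β) {len : Site d → ℝ}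
    (hlen : ∀ v : Site d, 0 < len v → 1 ≤ len v) (hlen1 : ∀ μ : Fin d, len (e μ) = 1) {c₁ c₁' B₁' cP C₂ B₀β : ℝ} {inp : B8.B9Inputs}
    (hB₁' : 0 < B₁') (hBB : 5 * (d : ℝ) * L * inp.B₀ ≤ B₁')
    (hwin : ∀ α₀ α₁ : ℝ, 0 < α₀ → 0 < α₁ → α₀ + α₁ ≤ c₁' →
      α₀ + α₁ ≤ c₁ ∧ C0 d * (2 * α₀) ≤ 1 / 3 ∧ 4 * α₀ ≤ c2' d L ∧ 16 * (B₁' * (α₀ + α₁)) ≤ 1 ∧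
      Real.exp (4 * (800 * ((d : ℝ) + 1) ^ 2 * ((d : ℝ) + 4)) * α₀) * (1 + 8 * (131072 * ((d : ℝ) + 1) ^ 2) * (B₁' * (α₀ + α₁))) ≤ 2 ∧
      2 * (B₁' * (α₀ + α₁)) ≤ c3 d L ∧ (d : ℝ) * L * α₁ ≤ 1 / 8 ∧ α₀ ≤ cP ∧ α₁ ≤ cP ∧ B₁' * (α₀ + α₁) ≤ cP ∧
      2 * (B₁' * (α₀ + α₁)) ^ 2 + 20 * d * α₀ * (B₁' * (α₀ + α₁)) + 2 * C₂ * (B₁' * (α₀ + α₁)) ^ 2 ≤ α₀ + α₁)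
    (Reg : ℕ → (Site d → Fin d → (Matrix n n ℂ)ˣ) → Prop) :
    letI : CStarAlgebra (Matrix n n ℂ) := {}
    B8.Thm4Body c₁ B₁' (fun i : {i : ZdIdx d L // (∀ j, i.Ω j = Set.univ) ∧ (∀ m j, i.Λs m j = {_y | j = m}) ∧ (∀ m j, i.Λb m j = {_c | j = m})} =>
      (zdGF3 (Matrix n n ℂ) L β len i.1).toGFData) →
    B8.Prop3Body cP d (L : ℝ) C₂ inp B₀β (fun i : {i : ZdIdx d L // (∀ j, i.Ω j = Set.univ) ∧ (∀ m j, i.Λs m j = {_y | j = m}) ∧ (∀ m j, i.Λb m j = {_c | j = m})} =>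
      (zdGF3 (Matrix n n ℂ) L β len i.1).toGFData2) →
    ∀ k, 1 ≤ k → Thm4TorusAt L k 0 (((L : ℝ) ^ k)⁻¹) c₁' (unitaryUnits (Matrix n n ℂ)) (Reg k) (Restr129 L k (torusLam k))
      (fun (α₀ α₁ : ℝ) (U₀ U' : Site d → Fin d → (Matrix n n ℂ)ˣ) (u : Site d → (Matrix n n ℂ)ˣ) =>
        ∃ A : Site d → Fin d → Matrix n n ℂ,
          (∀ x μ, IsSelfAdjoint (A x μ)) ∧ mgauge U₀ u (cfgExp (((L : ℝ) ^ k)⁻¹) A) = U' ∧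
          (∀ x μ, ‖A x μ‖ ≤ 5 * (d : ℝ) * L * inp.B₀ * (α₀ + α₁)) ∧
          (∀ (μ : Fin d) (x : Site d) (κ : Fin d),
            ‖covDerivFwd (((L : ℝ) ^ k)⁻¹) U₀ μ (fun z => A z κ) x‖ ≤ 5 * (d : ℝ) * L * inp.B₀ * (α₀ + α₁)) ∧
          IsLandau138 L k (((L : ℝ) ^ k)⁻¹) Set.univ (torusLam k) U₀ A ∧
          (∀ (μ : Fin d) (y : Site d) (κ : Fin d),
            ‖Ad (U₀ y μ) (covDerivFwd (((L : ℝ) ^ k)⁻¹) U₀ μ (fun z => A z κ) (y + e μ))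
                - covDerivFwd (((L : ℝ) ^ k)⁻¹) U₀ μ (fun z => A z κ) y‖
              ≤ 5 * (d : ℝ) * L * B₀β * (α₀ + α₁) * (((L : ℝ)⁻¹) ^ k) ^ β) ∧
          (∀ (x : Site d) (κ : Fin d), ‖covLap (((L : ℝ) ^ k)⁻¹) U₀ (fun z => A z κ) x‖ ≤ 5 * (d : ℝ) * L * inp.B₀ * (α₀ + α₁))) := by
  letI : CStarAlgebra (Matrix n n ℂ) := {}
  intro hT hP k hk
  have hL1 : 1 ≤ L := le_trans (by norm_num) hL
  have hL1r : (1 : ℝ) ≤ L := by exact_mod_cast hL1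
  have hLk : (1 : ℝ) ≤ (L : ℝ) ^ k := one_le_pow₀ hL1r
  have hη : 0 < ((L : ℝ) ^ k)⁻¹ := by positivity
  have hη1 : ((L : ℝ) ^ k)⁻¹ ≤ 1 := inv_le_one_of_one_le₀ hLk
  have h := thm4TorusAt_zero_print_of_leaf_allTorus hd2 hL hβ hlen hB₁' hBB hwin hT hP hk hη (Reg k)
  refine thm4TorusAt_concl_congr (fun α₀ α₁ U₀ U' u => ?_) h
  -- the letter identities at `η = L^{-k}`
  have hw : (L : ℝ) ^ k * ((L : ℝ) ^ k)⁻¹ = 1 := mul_inv_cancel₀ (by positivity)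
  have hw2 : ((L : ℝ) ^ k * ((L : ℝ) ^ k)⁻¹) ^ (-(2 : ℝ)) = 1 := by rw [hw, Real.one_rpow]
  have hw3 : ((L : ℝ) ^ k * ((L : ℝ) ^ k)⁻¹) ^ (-(3 : ℝ)) = 1 := by rw [hw, Real.one_rpow]
  have hwβ : ((L : ℝ) ^ k * ((L : ℝ) ^ k)⁻¹) ^ (-(2 + β)) = 1 := by rw [hw, Real.one_rpow]
  have hηβ : ∀ μ : Fin d, (((L : ℝ) ^ k)⁻¹ * len (e μ)) ^ β = (((L : ℝ)⁻¹) ^ k) ^ β := fun μ => by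
    rw [hlen1 μ, mul_one, inv_pow]
  have hadm : ∀ (μ : Fin d) (y : Site d), (y, y + e μ) ∈ AdmPair (((L : ℝ) ^ k)⁻¹) len := fun μ y => by
    rw [mem_admPair]
    simp only [add_sub_cancel_left, hlen1 μ, mul_one]
    exact ⟨one_pos, hη1⟩
  constructor
  · rintro ⟨A, h1, h2, h3, h4, h5, h6, h7⟩
    refine ⟨A, h1, h2, fun x μ => ?_, fun μ x κ => ?_, h5, fun μ y κ => ?_, fun x κ => ?_⟩
    · have h := h3 x μ; rwa [hw, inv_one, mul_one] at h
    · have h := h4 μ x κ; rwa [hw2, mul_one] at h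
    · have h := h6 μ y κ (hadm μ y); rwa [hwβ, mul_one, hηβ μ] at h
    · have h := h7 x κ; rwa [hw3, mul_one] at h
  · rintro ⟨A, h1, h2, h3, h4, h5, h6, h7⟩
    refine ⟨A, h1, h2, fun x μ => ?_, fun μ x κ => ?_, h5, fun μ y κ _ => ?_, fun x κ => ?_⟩
    · rw [hw, inv_one, mul_one]; exact h3 x μ
    · rw [hw2, mul_one]; exact h4 μ x κ
    · rw [hwβ, mul_one, hηβ μ]; exact h6 μ y κ
    · rw [hw3, mul_one]; exact h7 x κ

/-! ## §2 N16 ∕ NE3 (β = 1, the root of record) from the leaf clauses on the all-torus proper sub-family and N07's (H3ˢᵘᵖ) -/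

/-- **N16 · NE3 FROM THE [B8] LEAF ON THE ALL-TORUS PROPER SUB-FAMILY OF `zdGF3 (M_n(ℂ))` AND N07's (H3ˢᵘᵖ)** (`d = 4`, `L ≥ 2`, `N ≥ 1`, Hölder
exponent `β₀ = 1`, a length function `len ≥ 1` on its support with `len e_μ = 1`): generation 0's `N16.OfLeaf.n16_of_leaf` with the two leaf clauses
`B8.Thm4Body c₁ B₁′` ∧ `B8.Prop3Body cP 4 L C₂ inp B₀β` read on `fun i ↦ zdGF3 (M_n(ℂ)) L 1 len i.1` over the ALL-TORUS PROPER sub-index (instead of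
`{i // i.Ω 0 = univ}`); every other letter and the conclusion VERBATIM, ending in `LeafH3sup 4 L N ε b′ c′ dom → NE3EnergyRateWCov 4 (sfClass 4 L N ε) L
N b g C s₁ s₂ dom`.  N16 ∕ NE3 NOT proved: the two leaf clauses are node N05's theorems, (H3ˢᵘᵖ) is N07's. [cite: Balaban1985RegularSpaces, Thm 4 p.88, Prop. 3 p.87] [folklore] -/
theorem n16_of_leafAllTorus [Nonempty n] {L N : ℕ} (hL : 2 ≤ L) (hN : 1 ≤ N) :
    letI : CStarAlgebra (Matrix n n ℂ) := {}
    ∃ r : ℝ, 0 < r ∧ ∀ ⦃g : ℝ⦄, 0 < g → ∃ C : ℝ, 0 ≤ C ∧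
      ∀ (c₁ c₁' B₁' cP C₂ B₀β : ℝ) (inp : B8.B9Inputs) (len : Site 4 → ℝ), (∀ v : Site 4, 0 < len v → 1 ≤ len v) →
      (∀ μ : Fin 4, len (e μ) = 1) → 0 < B₁' → 5 * ((4 : ℕ) : ℝ) * L * inp.B₀ ≤ B₁' → 16 * (5 * ((4 : ℕ) : ℝ) * L * inp.B₀ * c₁') ≤ 1 →
      (∀ α₀ α₁ : ℝ, 0 < α₀ → 0 < α₁ → α₀ + α₁ ≤ c₁' →
        α₀ + α₁ ≤ c₁ ∧ C0 4 * (2 * α₀) ≤ 1 / 3 ∧ 4 * α₀ ≤ c2' 4 L ∧ 16 * (B₁' * (α₀ + α₁)) ≤ 1 ∧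
        Real.exp (4 * (800 * (((4 : ℕ) : ℝ) + 1) ^ 2 * (((4 : ℕ) : ℝ) + 4)) * α₀) *
            (1 + 8 * (131072 * (((4 : ℕ) : ℝ) + 1) ^ 2) * (B₁' * (α₀ + α₁))) ≤ 2 ∧
        2 * (B₁' * (α₀ + α₁)) ≤ c3 4 L ∧ ((4 : ℕ) : ℝ) * L * α₁ ≤ 1 / 8 ∧ α₀ ≤ cP ∧ α₁ ≤ cP ∧ B₁' * (α₀ + α₁) ≤ cP ∧
        2 * (B₁' * (α₀ + α₁)) ^ 2 + 20 * ((4 : ℕ) : ℝ) * α₀ * (B₁' * (α₀ + α₁)) + 2 * C₂ * (B₁' * (α₀ + α₁)) ^ 2 ≤ α₀ + α₁) →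
      ∀ ⦃b' c' : ℝ⦄, 0 ≤ b' → 0 ≤ c' →
      2 ^ 15 * ((4 : ℝ) + 1) ^ 2 * ((4 : ℝ) + 4) ^ 2 * (L : ℝ) ^ 2 * b' ≤ 1 →
      23040 * (4 : ℝ) ^ 4 * (frameC 4 L + 4) ^ 3 * (c' + curConst 4 L * b' ^ 2) ≤ 1 →
      ∀ ⦃α : ℝ⦄, 0 < α → C0 4 * α ≤ 1 / 3 → 2 * α ≤ c2' 4 L → 11 * (4 : ℝ) ^ 2 * α ≤ 1 / 6 → α + 11 * (4 : ℝ) ^ 2 * α ≤ c₁' →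
      b' + 226 * (8 * ((4 : ℝ) + 1) * ((4 : ℝ) + 4)) ^ 2 * b' ^ 2 < α → 4 * ((4 : ℝ) - 1) * (c' + curConst 4 L * b' ^ 2) < α →
      ∀ ⦃Mc : ℝ⦄, 0 ≤ Mc → (Mc + 1) * (b' + 226 * (8 * ((4 : ℝ) + 1) * ((4 : ℝ) + 4)) ^ 2 * b' ^ 2) ≤ 1 / 2 →
      ∀ (𝒬 : ℕ → Set (Set (Site 4) × ℕ)), (∀ k, ∀ q ∈ 𝒬 k, q.2 ≤ k ∧ ∃ y : Site 4, ∀ z ∈ q.1, (l1 (z - y) : ℝ) ≤ Mc * (L : ℝ) ^ q.2) →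
      ∀ ⦃C335 : ℝ⦄, 2 * (Mc + 1) * (b' + 226 * (8 * ((4 : ℝ) + 1) * ((4 : ℝ) + 4)) ^ 2 * b' ^ 2) + 2 * Mc * (2 * (c' + curConst 4 L * b' ^ 2)) +
        4 * Mc * (1 + 2 * Mc) * (b' + 226 * (8 * ((4 : ℝ) + 1) * ((4 : ℝ) + 4)) ^ 2 * b' ^ 2) ^ 2 < C335 →
      ∀ ⦃ε s₁ b s₂ : ℝ⦄, 0 < ε → ε ≤ r → ε < α → 0 ≤ s₁ → s₁ ≤ r → 0 ≤ b → b ≤ ε / 2 →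
      5 * ((4 : ℕ) : ℝ) * L * inp.B₀ * (α + 11 * (4 : ℝ) ^ 2 * α) ≤ s₁ →
      5 * ((4 : ℕ) : ℝ) * L * inp.B₀ * (α + 11 * (4 : ℝ) ^ 2 * α) +
          2 * (b' + 226 * (8 * ((4 : ℝ) + 1) * ((4 : ℝ) + 4)) ^ 2 * b' ^ 2) * s₁ ≤ s₁ →
      5 * ((4 : ℕ) : ℝ) * L * inp.B₀ * (α + 11 * (4 : ℝ) ^ 2 * α) + 16 * (b' + 226 * (8 * ((4 : ℝ) + 1) * ((4 : ℝ) + 4)) ^ 2 * b' ^ 2) *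
          (5 * ((4 : ℕ) : ℝ) * L * inp.B₀ * (α + 11 * (4 : ℝ) ^ 2 * α)) ≤ s₁ →
      5 * ((4 : ℕ) : ℝ) * L * B₀β * (α + 11 * (4 : ℝ) ^ 2 * α) + 8 * (b' + 226 * (8 * ((4 : ℝ) + 1) * ((4 : ℝ) + 4)) ^ 2 * b' ^ 2) *
          (5 * ((4 : ℕ) : ℝ) * L * inp.B₀ * (α + 11 * (4 : ℝ) ^ 2 * α)) ≤ s₂ →
      B8.Thm4Body c₁ B₁' (fun i : {i : ZdIdx 4 L // (∀ j, i.Ω j = Set.univ) ∧ (∀ m j, i.Λs m j = {_y | j = m}) ∧ (∀ m j, i.Λb m j = {_c | j = m})} =>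
        (zdGF3 (Matrix n n ℂ) L 1 len i.1).toGFData) →
      B8.Prop3Body cP 4 (L : ℝ) C₂ inp B₀β (fun i : {i : ZdIdx 4 L // (∀ j, i.Ω j = Set.univ) ∧ (∀ m j, i.Λs m j = {_y | j = m}) ∧ (∀ m j, i.Λb m j = {_c | j = m})} =>
        (zdGF3 (Matrix n n ℂ) L 1 len i.1).toGFData2) →
      ∀ {dom : _root_.Set (Site 4 → Fin 4 → (Matrix n n ℂ)ˣ)},
        LeafH3sup 4 L N ε b' c' dom →
        NE3EnergyRateWCov 4 (sfClass 4 L N ε) L N b g C s₁ s₂ dom := by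
  letI : CStarAlgebra (Matrix n n ℂ) := {}
  obtain ⟨r, hr0, hr⟩ := n16_of_thm4Zd_print (n := n) hL hN
  refine ⟨r, hr0, fun g hg => ?_⟩
  obtain ⟨C, hC0, hC⟩ := hr hg
  refine ⟨C, hC0, fun c₁ c₁' B₁' cP C₂ B₀β inp len hlen hlen1 hB₁' hBB h16 hwin b' c' hb' hc' hRb hcF α hα hA3 hA2 hAs hAc hb'α hc'α Mc hMc
    hMcα 𝒬 h𝒬 C335 hC335 ε s₁ b s₂ hε hεr hεα hs₁ hs₁r hb hbh hss hgrad hℓ hhol hT hP dom h3 => ?_⟩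
  have hB0 : 0 ≤ 5 * ((4 : ℕ) : ℝ) * L * inp.B₀ := by have := inp.B₀_pos.le; positivity
  have hT4 := thm4TorusAt_print_of_leaf_allTorus (d := 4) (by norm_num) hL zero_le_one hlen hlen1 hB₁' hBB hwin
    (fun k => Reg335Zd (((L : ℝ) ^ k)⁻¹) L (𝒬 k) C335) hT hP
  exact hC c₁' (5 * ((4 : ℕ) : ℝ) * L * inp.B₀) (5 * ((4 : ℕ) : ℝ) * L * B₀β) hB0 h16 hb' hc' hRb hcF hα hA3 hA2 hAs hAc hb'α hc'α hMc
    hMcα 𝒬 h𝒬 hC335 hε hεr hεα hs₁ hs₁r hb hbh hss hgrad hℓ hhol hT4 h3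


/-! ## §3 ★ N16 ∕ NE3 from n05-a's five sockets AT THE ALL-TORUS PROPER MEMBERS ONLY, and N07's (H3ˢᵘᵖ) -/

/-- ★ **N16 · NE3 (β = 1, THE DECL OF RECORD's ROOT) FROM NODE N05's FIVE SOCKETS ON THE ALL-TORUS PROPER SUB-FAMILY OF `zdGF3 (M_n(ℂ)) L 1 len` AND
N07's (H3ˢᵘᵖ)** (`d = 4`, `L ≥ 2`, `N ≥ 1`): generation 5's `N16OfSocketsZd3.n16_of_socketsZd3E` with n05-a's sockets `SockP5base ∕ SockP5 ∕ SockH59 ∕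
SockP5uE ∕ SockB9P3` demanded at the members `i` with `Ω_j = ℤ⁴` (all `j`), `Λs m j = {j = m}`, `Λb m j = {j = m}` (all truncations `m`) ONLY — the
members N16 reads, one per `(k, η)` — instead of at every univ member (where `SockH59` is unsatisfiable as a family,
`B8SockH59NotAtUnivDegenerate.not_forall_univ_sockH59`).  Socket letters, side letters, the window and THE END's tail VERBATIM, ending in `LeafH3sup 4 L
N ε b′ c′ dom → NE3EnergyRateWCov 4 (sfClass 4 L N ε) L N b g C s₁ s₂ dom`.  n05-a's `thm4Printed_zd3_mapE` ∕ `prop3Printed_zd3_map` at `ι :=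
Subtype.val` of the all-torus proper sub-index ∘ `n16_of_leafAllTorus`.  N16 ∕ NE3 NOT proved: the sockets there are node N05's ∕ N06's open obligations,
(H3ˢᵘᵖ) is N07's. [cite: Balaban1985RegularSpaces, Thm 4 p.88, Prop. 3 p.87, Prop. 5 p.94, (1.59) p.86, p.77 («Ω_j = T_η»)] [folklore] -/
theorem n16_of_socketsAllTorus [Nonempty n] {L N : ℕ} (hL : 2 ≤ L) (hN : 1 ≤ N) :
    letI : CStarAlgebra (Matrix n n ℂ) := {}
    ∃ r : ℝ, 0 < r ∧ ∀ ⦃g : ℝ⦄, 0 < g → ∃ C : ℝ, 0 ≤ C ∧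
      ∀ (C₂ B₀ B₀' cu cP : ℝ) (inp : B8.B9Inputs) (B₀β : ℝ) (len : Site 4 → ℝ),
      (∀ v : Site 4, 0 < len v → 1 ≤ len v) → (∀ μ : Fin 4, len (e μ) = 1) →
      0 < B₀ → inp.B₀ ≤ B₀ → 0 < B₀' → 2 ≤ 5 * ((4 : ℕ) : ℝ) * L * B₀ → 0 < cu → 0 < cP → 0 ≤ B₀β →
      2097152 * (((4 : ℕ) : ℝ) + 1) ^ 2 ≤ C₂ →
      (∀ i : {i : ZdIdx 4 L // (∀ j, i.Ω j = Set.univ) ∧ (∀ m j, i.Λs m j = {_y | j = m}) ∧ (∀ m j, i.Λb m j = {_c | j = m})}, SockP5base (𝔸 := Matrix n n ℂ) L B₀ B₀' cP i.1.η i.1.k i.1.Ω i.1.Λs) →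
      (∀ i : {i : ZdIdx 4 L // (∀ j, i.Ω j = Set.univ) ∧ (∀ m j, i.Λs m j = {_y | j = m}) ∧ (∀ m j, i.Λb m j = {_c | j = m})}, SockP5 (𝔸 := Matrix n n ℂ) L B₀ B₀' cP i.1.η i.1.k i.1.Ω i.1.Λs) →
      (∀ i : {i : ZdIdx 4 L // (∀ j, i.Ω j = Set.univ) ∧ (∀ m j, i.Λs m j = {_y | j = m}) ∧ (∀ m j, i.Λb m j = {_c | j = m})}, SockH59 (𝔸 := Matrix n n ℂ) L B₀ B₀' cP i.1.η i.1.k i.1.Ω i.1.Λs i.1.Λb) →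
      (∀ i : {i : ZdIdx 4 L // (∀ j, i.Ω j = Set.univ) ∧ (∀ m j, i.Λs m j = {_y | j = m}) ∧ (∀ m j, i.Λb m j = {_c | j = m})}, SockP5uE (𝔸 := Matrix n n ℂ) L B₀ cP cu i.1.η i.1.k i.1.Ω i.1.Λs) →
      (∀ i : {i : ZdIdx 4 L // (∀ j, i.Ω j = Set.univ) ∧ (∀ m j, i.Λs m j = {_y | j = m}) ∧ (∀ m j, i.Λb m j = {_c | j = m})}, SockB9P3 (𝔸 := Matrix n n ℂ) L inp.B₀ B₀β cP 1 len i.1.η i.1.k i.1.Ω i.1.Λs i.1.Λb) →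
      ∃ c₁' : ℝ, 0 < c₁' ∧ 16 * (5 * ((4 : ℕ) : ℝ) * L * inp.B₀ * c₁') ≤ 1 ∧
      ∀ ⦃b' c' : ℝ⦄, 0 ≤ b' → 0 ≤ c' →
      2 ^ 15 * ((4 : ℝ) + 1) ^ 2 * ((4 : ℝ) + 4) ^ 2 * (L : ℝ) ^ 2 * b' ≤ 1 →
      23040 * (4 : ℝ) ^ 4 * (frameC 4 L + 4) ^ 3 * (c' + curConst 4 L * b' ^ 2) ≤ 1 →
      ∀ ⦃α : ℝ⦄, 0 < α → C0 4 * α ≤ 1 / 3 → 2 * α ≤ c2' 4 L → 11 * (4 : ℝ) ^ 2 * α ≤ 1 / 6 → α + 11 * (4 : ℝ) ^ 2 * α ≤ c₁' →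
      b' + 226 * (8 * ((4 : ℝ) + 1) * ((4 : ℝ) + 4)) ^ 2 * b' ^ 2 < α → 4 * ((4 : ℝ) - 1) * (c' + curConst 4 L * b' ^ 2) < α →
      ∀ ⦃Mc : ℝ⦄, 0 ≤ Mc → (Mc + 1) * (b' + 226 * (8 * ((4 : ℝ) + 1) * ((4 : ℝ) + 4)) ^ 2 * b' ^ 2) ≤ 1 / 2 →
      ∀ (𝒬 : ℕ → Set (Set (Site 4) × ℕ)), (∀ k, ∀ q ∈ 𝒬 k, q.2 ≤ k ∧ ∃ y : Site 4, ∀ z ∈ q.1, (l1 (z - y) : ℝ) ≤ Mc * (L : ℝ) ^ q.2) →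
      ∀ ⦃C335 : ℝ⦄, 2 * (Mc + 1) * (b' + 226 * (8 * ((4 : ℝ) + 1) * ((4 : ℝ) + 4)) ^ 2 * b' ^ 2) + 2 * Mc * (2 * (c' + curConst 4 L * b' ^ 2)) +
        4 * Mc * (1 + 2 * Mc) * (b' + 226 * (8 * ((4 : ℝ) + 1) * ((4 : ℝ) + 4)) ^ 2 * b' ^ 2) ^ 2 < C335 →
      ∀ ⦃ε s₁ b s₂ : ℝ⦄, 0 < ε → ε ≤ r → ε < α → 0 ≤ s₁ → s₁ ≤ r → 0 ≤ b → b ≤ ε / 2 →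
      5 * ((4 : ℕ) : ℝ) * L * inp.B₀ * (α + 11 * (4 : ℝ) ^ 2 * α) ≤ s₁ →
      5 * ((4 : ℕ) : ℝ) * L * inp.B₀ * (α + 11 * (4 : ℝ) ^ 2 * α) +
          2 * (b' + 226 * (8 * ((4 : ℝ) + 1) * ((4 : ℝ) + 4)) ^ 2 * b' ^ 2) * s₁ ≤ s₁ →
      5 * ((4 : ℕ) : ℝ) * L * inp.B₀ * (α + 11 * (4 : ℝ) ^ 2 * α) + 16 * (b' + 226 * (8 * ((4 : ℝ) + 1) * ((4 : ℝ) + 4)) ^ 2 * b' ^ 2) *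
          (5 * ((4 : ℕ) : ℝ) * L * inp.B₀ * (α + 11 * (4 : ℝ) ^ 2 * α)) ≤ s₁ →
      5 * ((4 : ℕ) : ℝ) * L * B₀β * (α + 11 * (4 : ℝ) ^ 2 * α) + 8 * (b' + 226 * (8 * ((4 : ℝ) + 1) * ((4 : ℝ) + 4)) ^ 2 * b' ^ 2) *
          (5 * ((4 : ℕ) : ℝ) * L * inp.B₀ * (α + 11 * (4 : ℝ) ^ 2 * α)) ≤ s₂ →
      ∀ {dom : _root_.Set (Site 4 → Fin 4 → (Matrix n n ℂ)ˣ)},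
        LeafH3sup 4 L N ε b' c' dom →
        NE3EnergyRateWCov 4 (sfClass 4 L N ε) L N b g C s₁ s₂ dom := by
  letI : CStarAlgebra (Matrix n n ℂ) := {}
  obtain ⟨r, hr0, hr⟩ := n16_of_leafAllTorus (n := n) hL hN
  refine ⟨r, hr0, fun g hg => ?_⟩
  obtain ⟨C, hC0, hC⟩ := hr hg
  refine ⟨C, hC0, fun C₂ B₀ B₀' cu cP inp B₀β len hlen hlen1 hB₀ hiB hB₀' hB hcu hcP hB₀β hC₂ SP5base SP5 SH59 SP5u SB9 => ?_⟩
  -- node N05's Theorem 4 ∕ Proposition 3 on the ALL-TORUS PROPER sub-family from the sockets there (n05-a, `ι := Subtype.val`)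
  obtain ⟨c₁t, hc₁t, hT⟩ := B8LeafKnitZd3E.thm4Printed_zd3_mapE (𝔸 := Matrix n n ℂ) (d := 4) (by norm_num) hL (β := (1 : ℝ))
    (len := len) hB₀ hB₀' hB hcu hcP (fun i : {i : ZdIdx 4 L // (∀ j, i.Ω j = Set.univ) ∧ (∀ m j, i.Λs m j = {_y | j = m}) ∧ (∀ m j, i.Λb m j = {_c | j = m})} => i.1) SP5base SP5 SH59 SP5u
  obtain ⟨cP', hcP', hP⟩ := B8LeafModelZd3Map.prop3Printed_zd3_map (𝔸 := Matrix n n ℂ) (d := 4) (by norm_num) hL inp hB₀β hC₂ hcP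
    (1 : ℝ) len (fun i : {i : ZdIdx 4 L // (∀ j, i.Ω j = Set.univ) ∧ (∀ m j, i.Λs m j = {_y | j = m}) ∧ (∀ m j, i.Λb m j = {_c | j = m})} => i.1) SB9
  -- the letter `B₁′ := 5·4·L·B₀` and the window threshold below the two printed thresholds
  have hLpos : (0 : ℝ) < L := by exact_mod_cast (show 0 < L by omega)
  have hB₁' : 0 < 5 * ((4 : ℕ) : ℝ) * L * B₀ := by positivity
  have hBB : 5 * ((4 : ℕ) : ℝ) * L * inp.B₀ ≤ 5 * ((4 : ℕ) : ℝ) * L * B₀ := mul_le_mul_of_nonneg_left hiB (by positivity)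
  obtain ⟨c₁', hc₁', hwin⟩ := exists_window_print (d := 4) (L := L) (by norm_num) hL C₂ hc₁t hcP' hB₁'
  have h16 : 16 * (5 * ((4 : ℕ) : ℝ) * L * inp.B₀ * c₁') ≤ 1 := by
    obtain ⟨-, -, -, h, -⟩ := hwin (c₁' / 2) (c₁' / 2) (by linarith) (by linarith) (by linarith)
    have h' : 16 * (5 * ((4 : ℕ) : ℝ) * L * B₀ * c₁') ≤ 1 := by rwa [add_halves] at h
    nlinarith [mul_le_mul_of_nonneg_right hBB hc₁'.le]
  refine ⟨c₁', hc₁', h16, fun b' c' hb' hc' hRb hcF α hα hA3 hA2 hAs hAc hb'α hc'α Mc hMc hMcα 𝒬 h𝒬 C335 hC335 ε s₁ b s₂ hε hεr hεα hs₁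
    hs₁r hb hbh hss hgrad hℓ hhol dom h3 => ?_⟩
  exact hC c₁t c₁' (5 * ((4 : ℕ) : ℝ) * L * B₀) cP' C₂ B₀β inp len hlen hlen1 hB₁' hBB h16 hwin hb' hc' hRb hcF hα hA3 hA2 hAs hAc hb'α hc'α
    hMc hMcα 𝒬 h𝒬 hC335 hε hεr hεα hs₁ hs₁r hb hbh hss hgrad hℓ hhol hT hP h3

end Matrices

end

end Summit.QuantumFields.YangMills.BalabanUVNodes.N16OfSocketsAllTorus
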